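import Literature.NumberTheory.Transcendental.PkappaTheta
import Literature.NumberTheory.Transcendental.UnivExtThetaAddition
import HarnessLib

/-!
# The addition law of the theta model of `M_κ = 𝔾ₘ^β × P_κ`

Topic: `Literature/NumberTheory/Transcendental`. A brick of the programme towards the named fact
`Literature.NumberTheory.Transcendental.philippon1986_std` (Philippon's zero estimate, Bull. SMF
114 (1986), Thm. 2.1, for the groups `M_κ` in the theta embedding `GaGmE.Std.theta` of
`PkappaTheta.lean`): the **translation structure** of the theta model, i.e. an addition law in
the sense of Masser–Wüstholz 1981 §2 / Roy (LNM 1752, Ch. 11, §2.1) — with the first argument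
polynomial and the second analytic, which is the form used by Roy's Prop. 3.6 (iv) (the degree of
`∂_ξ^κ P(A(X, ψ_σ(ξ)))|_{ξ=0}` in `X` does not depend on the order `κ`).

For `w, u ∈ Lie M_κ,ℂ` write `z', t'` for their `E`-blocks (`GaGmE.Std.iz`), `s, s'` for their
vector coordinates (`GaGmE.Std.is`), `P(z'_b) = (P₀,P₁,P₂)(z'_b)` and `Z(z'_b)` for the block and
companion vectors (`GaGmE.Std.blockP`, `GaGmE.Std.blockZ`, from `UnivExtTheta.lean`), and let
`α^{(i)}_{jk}`, `a^{(i)}_{jk;lm}`, `γ^{(i)}_{lm}` be the coefficient forms / tensors of the chord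
law of the cubic (`UnivExtThetaAddition.lean`; the constant tensors `PeriodPair.chordCoeff₂`,
`PeriodPair.chordC₂` and the forms `PeriodPair.chordCcoeff` are introduced here, with the expansion
lemmas `chordCoeff_eq_sum`, `chordC_eq_sum`, `chordB_eq_sum_left`). PROVED, for ALL `w, u`
(identities of entire functions, no exceptional set):

* `GaGmE.Std.theta_add_none` —
  `μ(w,u) · Θ_{(a,(M,none))}(w + u) = ∑_{J,K} T_a(u) c_{M;J,K}(u) · Θ_{(a,(J,none))}(w) Θ_{(none,(K,none))}(w)`;
* `GaGmE.Std.theta_add_some` —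
  `μ(w,u) · Θ_{(a,(M,some e))}(w + u) = ∑_{J,K} T_a(u) c_{M;J,K}(u) · Θ_{(a,(J,some e))}(w) Θ_{(none,(K,none))}(w)`
  `+ ∑_{J,K} T_a(u) d^e_{M;J,K}(u) · Θ_{(a,(J,none))}(w) Θ_{(none,(K,none))}(w)`,

where (`GaGmE.Std.addUnit`, `addCoeffP`, `addCoeffS`, `thetaT`)
* the **unit** `μ(w, u) = ∏_b (-σ(z'_b - t'_b)³)` is entire in `(w, u)` (`differentiable_addUnit`)
  and non-zero exactly off the block diagonals `z'_b ≡ t'_b (mod Λ)` (`addUnit_ne_zero_iff`);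
* `c_{M;J,K}(u) = ∏_b α^{(M_b)}_{J_bK_b}(P(t'_b))` and
  `d^e_{M;J,K}(u) = s'_e c_{M;J,K}(u) + ∑_b κ_{eb}(∑_{jk} a^{(M_b)}_{jk;J_bK_b} Z_j(t'_b)P_k(t'_b) - γ^{(M_b)}_{J_bK_b}(P(t'_b))) ∏_{b'≠b} α^{(M_{b'})}_{J_{b'}K_{b'}}(P(t'_{b'}))`
  are ENTIRE functions of `u` (`differentiable_addCoeffP`, `differentiable_addCoeffS`).

So for fixed `u` the translate `w ↦ Θ_J(w + u)` is, up to the unit `μ(·, u)`, a quadratic form in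
`Θ(w)` (bidegree `(2, 2)`: the coefficients are themselves quadratic in `Θ(u)`, though only their
holomorphy is recorded), linear in the fibre sections, with the same coefficients `c` on blocks and
fibre sections. `exists_aux_point` provides, for any pair of points `(a, σ)`, an intermediate point
off the relevant block diagonals, through which two such laws compose to one whose unit does not
vanish at `(a, σ)` (sequel: the analytic addition law at every point, degree `4`).

Proof: blockwise the chord law `A_i(P(z),P(t)) = -σ(z-t)³P_i(z+t)` and its companion
`B_i(P(t);Z(z),P(z)) - B_i(P(z);Z(t),P(t)) + C_i(P(z),P(t)) = -σ(z-t)³Z_i(z+t)`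
(`PeriodPair.chordA_univExtP`, `PeriodPair.chord_companion`); then Segre expansion of the product
over the blocks (`prod_sum_sum_eq`: `∏_b ∑_{j,k} = ∑_{J,K} ∏_b`), the `b`-th summand of a fibre
section being handled by splitting the product at `b` (`addUnit_mul_companion_prod`,
`chordB_mul_prod_chordA`, `rest_mul_prod_chordA`); the symmetric first-slot convention for the
companion makes the fibre-section coefficients coincide with the block coefficients
(`thetaPsome_add`).

## References

* D. W. Masser, G. Wüstholz, *Zero estimates on group varieties I*, Invent. Math. 64 (1981),
  489–516, §2 (addition laws). [MasserWustholz1981]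
* Yu. V. Nesterenko, P. Philippon (eds.), *Introduction to Algebraic Independence Theory*,
  LNM 1752, Springer 2001, Ch. 11 (D. Roy), §2.1, Prop. 3.6 (iv) and its proof (pp. 212–214).
  [NesterenkoPhilippon2001]
* H. Lange, W. Ruppert, *Complete systems of addition laws on abelian varieties*, Invent. Math.
  79 (1985), 603–610. [LangeRuppert1985]
* A. Baker, G. Wüstholz, *Logarithmic Forms and Diophantine Geometry*, CUP 2007, §6.9
  (projective embeddings of commutative group varieties). [BakerWustholz2007]
-/

noncomputable section

open Complex
open scoped PeriodPair

namespace Literature.NumberTheory.Transcendental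

/-! ### Coefficient tensors of the chord law (constants) -/

variable (L : PeriodPair)

/-- The constant coefficient tensor `a^{(i)}_{jk;lm}` of the chord law:
`α^{(i)}_{jk}(y) = ∑_{l,m} a^{(i)}_{jk;lm} y_l y_m` (symmetric in `(l, m)`), i.e.
`A_i(x, y) = ∑ a^{(i)}_{jk;lm} x_j x_k y_l y_m`. Dot-notation extension of Mathlib's `PeriodPair`
(entries in `ℚ[g₂, g₃]`). [folklore] -/
def _root_.PeriodPair.chordCoeff₂ (i j k l m : Fin 3) : ℂ :=
    ![![![![![0, (-1 / 8 : ℂ) * L.g₂, 0], ![(-1 / 8 : ℂ) * L.g₂, 0, 0], ![0,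
     0, (-1 / 4 : ℂ)]], ![![(1 / 8 : ℂ) * L.g₂, 0, 0], ![0, (3 / 2 : ℂ), 0],
     ![0, 0, 0]], ![![0, 0, 0], ![0, 0, 0], ![0, 0, 0]]], ![![![(1 / 8 : ℂ) * L.g₂,
     0, 0], ![0, (3 / 2 : ℂ), 0], ![0, 0, 0]], ![![0, (-3 / 2 : ℂ), 0], ![(-3 / 2 : ℂ),
     0, 0], ![0, 0, 0]], ![![0, 0, 0], ![0, 0, 0], ![0, 0, 0]]], ![![![0, 0,
     0], ![0, 0, 0], ![0, 0, 0]], ![![0, 0, 0], ![0, 0, 0], ![0, 0, 0]], ![![(1 / 4 : ℂ),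
     0, 0], ![0, 0, 0], ![0, 0, 0]]]], ![![![![0, (3 / 8 : ℂ) * L.g₃, 0], ![(3 / 8 : ℂ) * L.g₃,
     (1 / 4 : ℂ) * L.g₂, 0], ![0, 0, 0]], ![![(-3 / 8 : ℂ) * L.g₃, 0, 0], ![0,
     0, 0], ![0, 0, (-1 / 8 : ℂ)]], ![![0, 0, 0], ![0, 0, (1 / 8 : ℂ)], ![0,
     (1 / 8 : ℂ), 0]]], ![![![(-3 / 8 : ℂ) * L.g₃, 0, 0], ![0, 0, 0], ![0, 0,
     (-1 / 8 : ℂ)]], ![![(-1 / 4 : ℂ) * L.g₂, 0, 0], ![0, 0, 0], ![0, 0, 0]],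
     ![![0, 0, (-1 / 8 : ℂ)], ![0, 0, 0], ![(-1 / 8 : ℂ), 0, 0]]], ![![![0, 0,
     0], ![0, 0, (1 / 8 : ℂ)], ![0, (1 / 8 : ℂ), 0]], ![![0, 0, (-1 / 8 : ℂ)],
     ![0, 0, 0], ![(-1 / 8 : ℂ), 0, 0]], ![![0, (1 / 8 : ℂ), 0], ![(1 / 8 : ℂ),
     0, 0], ![0, 0, 0]]]], ![![![![0, 0, (-3 / 8 : ℂ) * L.g₃], ![0, 0, (-1 / 8 : ℂ) * L.g₂],
     ![(-3 / 8 : ℂ) * L.g₃, (-1 / 8 : ℂ) * L.g₂, 0]], ![![0, 0, (-1 / 8 : ℂ) * L.g₂],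
     ![0, 0, 0], ![(-1 / 8 : ℂ) * L.g₂, 0, 0]], ![![(3 / 8 : ℂ) * L.g₃, (1 / 8 : ℂ) * L.g₂,
     0], ![(1 / 8 : ℂ) * L.g₂, 0, 0], ![0, 0, (-1 / 8 : ℂ)]]], ![![![0, 0, (-1 / 8 : ℂ) * L.g₂],
     ![0, 0, 0], ![(-1 / 8 : ℂ) * L.g₂, 0, 0]], ![![0, 0, 0], ![0, 0, (3 / 2 : ℂ)],
     ![0, (3 / 2 : ℂ), 0]], ![![(1 / 8 : ℂ) * L.g₂, 0, 0], ![0, (-3 / 2 : ℂ),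
     0], ![0, 0, 0]]], ![![![(3 / 8 : ℂ) * L.g₃, (1 / 8 : ℂ) * L.g₂, 0], ![(1 / 8 : ℂ) * L.g₂,
     0, 0], ![0, 0, (-1 / 8 : ℂ)]], ![![(1 / 8 : ℂ) * L.g₂, 0, 0], ![0, (-3 / 2 : ℂ),
     0], ![0, 0, 0]], ![![0, 0, (1 / 8 : ℂ)], ![0, 0, 0], ![(1 / 8 : ℂ), 0, 0]]]]] i j k l m

/-- The coefficient forms are the quadratic forms of the tensor `a`. [folklore] -/
theorem _root_.PeriodPair.chordCoeff_eq_sum (i j k : Fin 3) (y : Fin 3 → ℂ) :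
    L.chordCoeff i j k y = ∑ l : Fin 3, ∑ m : Fin 3, L.chordCoeff₂ i j k l m * (y l * y m) := by
  simp only [Fin.sum_univ_three]
  fin_cases i <;> fin_cases j <;> fin_cases k <;>
    simp [PeriodPair.chordCoeff, PeriodPair.chordCoeff₂] <;> ring

/-- The constant coefficient tensor `c^{(i)}_{lm;l′m′}` of the correction forms:
`C_i(x, y) = ∑ c^{(i)}_{lm;l′m′} x_l x_m y_{l′} y_{m′}` (symmetric in `(l, m)` and in `(l′, m′)`).
Dot-notation extension of Mathlib's `PeriodPair`. [folklore] -/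
def _root_.PeriodPair.chordC₂ (i l m l' m' : Fin 3) : ℂ :=
    ![![![![![0, 0, 0], ![0, 0, 0], ![0, 0, 0]], ![![0, 0, 0], ![0, 0, (1 / 4 : ℂ)],
     ![0, (1 / 4 : ℂ), 0]], ![![0, 0, 0], ![0, (1 / 4 : ℂ), 0], ![0, 0, 0]]],
     ![![![0, 0, 0], ![0, 0, (1 / 4 : ℂ)], ![0, (1 / 4 : ℂ), 0]], ![![0, 0, (-1 / 4 : ℂ)],
     ![0, 0, 0], ![(-1 / 4 : ℂ), 0, 0]], ![![0, (-1 / 4 : ℂ), 0], ![(-1 / 4 : ℂ),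
     0, 0], ![0, 0, 0]]], ![![![0, 0, 0], ![0, (1 / 4 : ℂ), 0], ![0, 0, 0]],
     ![![0, (-1 / 4 : ℂ), 0], ![(-1 / 4 : ℂ), 0, 0], ![0, 0, 0]], ![![0, 0, 0],
     ![0, 0, 0], ![0, 0, 0]]]], ![![![![0, 0, (3 / 16 : ℂ) * L.g₃], ![0, 0, (1 / 16 : ℂ) * L.g₂],
     ![(3 / 16 : ℂ) * L.g₃, (1 / 16 : ℂ) * L.g₂, 0]], ![![0, 0, (1 / 16 : ℂ) * L.g₂],
     ![0, 0, 0], ![(1 / 16 : ℂ) * L.g₂, 0, 0]], ![![(-3 / 16 : ℂ) * L.g₃, (-1 / 16 : ℂ) * L.g₂,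
     0], ![(-1 / 16 : ℂ) * L.g₂, 0, 0], ![0, 0, (1 / 16 : ℂ)]]], ![![![0, 0,
     (1 / 16 : ℂ) * L.g₂], ![0, 0, 0], ![(1 / 16 : ℂ) * L.g₂, 0, 0]], ![![0,
     0, 0], ![0, 0, (-1 / 2 : ℂ)], ![0, (-1 / 2 : ℂ), 0]], ![![(-1 / 16 : ℂ) * L.g₂,
     0, 0], ![0, (1 / 2 : ℂ), 0], ![0, 0, 0]]], ![![![(-3 / 16 : ℂ) * L.g₃, (-1 / 16 : ℂ) * L.g₂,
     0], ![(-1 / 16 : ℂ) * L.g₂, 0, 0], ![0, 0, (1 / 16 : ℂ)]], ![![(-1 / 16 : ℂ) * L.g₂,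
     0, 0], ![0, (1 / 2 : ℂ), 0], ![0, 0, 0]], ![![0, 0, (-1 / 16 : ℂ)], ![0,
     0, 0], ![(-1 / 16 : ℂ), 0, 0]]]], ![![![![0, (-1 / 32 : ℂ) * L.g₂ ^ 2, 0],
     ![(-1 / 32 : ℂ) * L.g₂ ^ 2, 0, 0], ![0, 0, (-1 / 16 : ℂ) * L.g₂]],
      ![![(1 / 32 : ℂ) * L.g₂ ^ 2, 0, 0], ![0, (3 / 8 : ℂ) * L.g₂, 0], ![0, 0,
     0]], ![![0, 0, 0], ![0, 0, 0], ![0, 0, 0]]], ![![![(1 / 32 : ℂ) * L.g₂ ^ 2,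
     0, 0], ![0, (3 / 8 : ℂ) * L.g₂, 0], ![0, 0, 0]], ![![0, (-3 / 8 : ℂ) * L.g₂,
     0], ![(-3 / 8 : ℂ) * L.g₂, 0, 0], ![0, 0, (1 / 2 : ℂ)]], ![![0, 0, 0], ![0,
     0, 0], ![0, 0, 0]]], ![![![0, 0, 0], ![0, 0, 0], ![0, 0, 0]], ![![0, 0,
     0], ![0, 0, 0], ![0, 0, 0]], ![![(1 / 16 : ℂ) * L.g₂, 0, 0], ![0, (-1 / 2 : ℂ),
     0], ![0, 0, 0]]]]] i l m l' m'

/-- The `x`-coefficient forms of the correction: `C_i(x, y) = ∑_{l,m} γ^{(i)}_{lm}(y) x_l x_m` with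
`γ^{(i)}_{lm}(y) = ∑_{l′,m′} c^{(i)}_{lm;l′m′} y_{l′} y_{m′}`. Dot-notation extension of Mathlib's
`PeriodPair`. [folklore] -/
def _root_.PeriodPair.chordCcoeff (i l m : Fin 3) (y : Fin 3 → ℂ) : ℂ :=
  ∑ l' : Fin 3, ∑ m' : Fin 3, L.chordC₂ i l m l' m' * (y l' * y m')

/-- Expansion of the correction forms in `x`. [folklore] -/
theorem _root_.PeriodPair.chordC_eq_sum (i : Fin 3) (x y : Fin 3 → ℂ) :
    L.chordC i x y = ∑ l : Fin 3, ∑ m : Fin 3, L.chordCcoeff i l m y * (x l * x m) := by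
  simp only [PeriodPair.chordCcoeff, Fin.sum_univ_three]
  fin_cases i <;> simp [PeriodPair.chordC, PeriodPair.chordC₂] <;> ring

/-- Expansion of the polarised law in its first (quadratic) slot:
`B_i(y; v, x) = ∑_{l,m} (∑_{j,k} a^{(i)}_{jk;lm} v_j x_k) y_l y_m`. [folklore] -/
theorem _root_.PeriodPair.chordB_eq_sum_left (i : Fin 3) (y v x : Fin 3 → ℂ) :
    L.chordB i y v x = ∑ l : Fin 3, ∑ m : Fin 3,
      (∑ j : Fin 3, ∑ k : Fin 3, L.chordCoeff₂ i j k l m * (v j * x k)) * (y l * y m) := by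
  simp only [PeriodPair.chordB, L.chordCoeff_eq_sum, Fin.sum_univ_three]
  ring

/-! ### A product of double sums over the blocks -/

/-- **Segre expansion over the blocks**: a product over `b` of double sums
`∑_{j,k} a_b(j,k) v_b(j) x_b(k)` is the double sum over multi-indices `J, K` of
`(∏_b a_b(J_b, K_b)) · (∏_b v_b(J_b)) · (∏_b x_b(K_b))`. [folklore] -/
theorem prod_sum_sum_eq {ι : Type} [Fintype ι] [DecidableEq ι] (a : ι → Fin 3 → Fin 3 → ℂ)
    (v x : ι → Fin 3 → ℂ) :
    ∏ b, ∑ j : Fin 3, ∑ k : Fin 3, a b j k * (v b j * x b k) =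
      ∑ J : ι → Fin 3, ∑ K : ι → Fin 3,
        (∏ b, a b (J b) (K b)) * ((∏ b, v b (J b)) * ∏ b, x b (K b)) := by
  rw [Finset.prod_univ_sum (fun _ => Finset.univ) (fun b j => ∑ k, a b j k * (v b j * x b k)),
    Fintype.piFinset_univ]
  refine Finset.sum_congr rfl fun J _ => ?_
  rw [Finset.prod_univ_sum (fun _ => Finset.univ) (fun b k => a b (J b) k * (v b (J b) * x b k)),
    Fintype.piFinset_univ]
  refine Finset.sum_congr rfl fun K _ => ?_
  rw [Finset.prod_mul_distrib, Finset.prod_mul_distrib]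

namespace GaGmE

namespace Std

variable {β γ δ : Type} [Fintype β] [Fintype γ] [Fintype δ] [DecidableEq γ]
variable (κM : δ → γ → Kbar)

/-! ### Blocks, the unit and the coefficients of the law -/

/-- The `E`-block vector `(P₀, P₁, P₂)(z'_b)` of `w`. [folklore] -/
def blockP (w : β ⊕ (γ ⊕ δ) → ℂ) (b : γ) : Fin 3 → ℂ := fun j => L.univExtP j (w (iz b))

/-- The `ζ`-companion vector `(Z₀, Z₁, Z₂)(z'_b)` of `w`. [folklore] -/
def blockZ (w : β ⊕ (γ ⊕ δ) → ℂ) (b : γ) : Fin 3 → ℂ := fun j => L.univExtZ j (w (iz b))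

omit [Fintype β] [Fintype γ] [Fintype δ] [DecidableEq γ] in
/-- Components of the block vector. [folklore] -/
@[simp] theorem blockP_apply (w : β ⊕ (γ ⊕ δ) → ℂ) (b : γ) (j : Fin 3) :
    blockP L w b j = L.univExtP j (w (iz b)) := rfl

omit [Fintype β] [Fintype γ] [Fintype δ] [DecidableEq γ] in
/-- Components of the companion vector. [folklore] -/
@[simp] theorem blockZ_apply (w : β ⊕ (γ ⊕ δ) → ℂ) (b : γ) (j : Fin 3) :
    blockZ L w b j = L.univExtZ j (w (iz b)) := rfl

/-- **The unit of the law**: `μ(w, u) = ∏_b (-σ(z'_b - t'_b)³)` (`z' = z`-block of `w`,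
`t' = z`-block of `u`). [folklore] -/
def addUnit (w u : β ⊕ (γ ⊕ δ) → ℂ) : ℂ :=
  ∏ b : γ, -(L.weierstrassSigma (w (iz b) - u (iz b)) ^ 3)

omit [Fintype β] [Fintype δ] [DecidableEq γ] in
/-- `μ(w, u) ≠ 0` iff `w` and `u` are off all block diagonals: `z'_b - t'_b ∉ Λ` for all `b`.
[folklore] -/
theorem addUnit_ne_zero_iff (w u : β ⊕ (γ ⊕ δ) → ℂ) :
    addUnit (β := β) (δ := δ) L w u ≠ 0 ↔ ∀ b, w (iz b) - u (iz b) ∉ L.lattice := by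
  rw [addUnit, Finset.prod_ne_zero_iff]
  simp only [Finset.mem_univ, true_implies, neg_ne_zero]
  exact forall_congr' fun b => L.sigma_sub_pow_ne_zero_iff _ _

/-- **The coefficients of the law on the blocks**:
`c_{M;J,K}(u) = ∏_b α^{(M_b)}_{J_b K_b}(P(t'_b))`. [folklore] -/
def addCoeffP (M J K : γ → Fin 3) (u : β ⊕ (γ ⊕ δ) → ℂ) : ℂ :=
  ∏ b, L.chordCoeff (M b) (J b) (K b) (blockP L u b)

/-- **The coefficients of the law on the fibre coordinates** (the part of the translate of a
fibre section that is a form in the block coordinates alone):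
`d^{e}_{M;J,K}(u) = s_e(u) c_{M;J,K}(u) + ∑_b κ_{eb} (∑_{j,k} a^{(M_b)}_{jk;J_bK_b} Z_j(t'_b)P_k(t'_b)
  - γ^{(M_b)}_{J_bK_b}(P(t'_b))) ∏_{b'≠b} α^{(M_{b'})}_{J_{b'}K_{b'}}(P(t'_{b'}))`. [folklore] -/
def addCoeffS (M : γ → Fin 3) (e : δ) (J K : γ → Fin 3) (u : β ⊕ (γ ⊕ δ) → ℂ) : ℂ :=
  u (is e) * addCoeffP L M J K u +
    ∑ b, (κM e b : ℂ) *
      (((∑ j : Fin 3, ∑ k : Fin 3,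
          L.chordCoeff₂ (M b) j k (J b) (K b) * (blockZ L u b j * blockP L u b k)) -
        L.chordCcoeff (M b) (J b) (K b) (blockP L u b)) *
      ∏ b' ∈ Finset.univ.erase b, L.chordCoeff (M b') (J b') (K b') (blockP L u b'))

/-! ### The law on the products `Θ^P_{(M, none)}` -/

omit [Fintype β] [Fintype δ] [DecidableEq γ] in
/-- `μ(w,u) · ∏_b P_{M_b}(z'_b + t'_b) = ∏_b A_{M_b}(P(z'_b), P(t'_b))`. [folklore] -/
theorem addUnit_mul_thetaPnone (M : γ → Fin 3) (w u : β ⊕ (γ ⊕ δ) → ℂ) :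
    addUnit (β := β) (δ := δ) L w u * thetaPnone (β := β) (δ := δ) L M (w + u) =
      ∏ b, L.chordA (M b) (blockP L w b) (blockP L u b) := by
  unfold addUnit thetaPnone
  rw [← Finset.prod_mul_distrib]
  refine Finset.prod_congr rfl fun b _ => ?_
  rw [Pi.add_apply, show blockP L w b = fun j => L.univExtP j (w (iz b)) from rfl,
    show blockP L u b = fun j => L.univExtP j (u (iz b)) from rfl, L.chordA_univExtP]
  ring

omit [Fintype β] [Fintype δ] in
/-- **The addition law for `Θ^P_{(M, none)}`**:
`μ(w, u) Θ^P_{(M,none)}(w + u) = ∑_{J,K} c_{M;J,K}(u) Θ^P_{(J,none)}(w) Θ^P_{(K,none)}(w)`. [folklore] -/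
theorem thetaPnone_add (M : γ → Fin 3) (w u : β ⊕ (γ ⊕ δ) → ℂ) :
    addUnit (β := β) (δ := δ) L w u * thetaPnone (β := β) (δ := δ) L M (w + u) =
      ∑ J : γ → Fin 3, ∑ K : γ → Fin 3,
        addCoeffP L M J K u * (thetaPnone (β := β) (δ := δ) L J w * thetaPnone (β := β) (δ := δ) L K w) := by
  rw [addUnit_mul_thetaPnone]
  simp only [PeriodPair.chordA]
  exact prod_sum_sum_eq (fun b j k => L.chordCoeff (M b) j k (blockP L u b)) (blockP L w) (blockP L w)

/-! ### The law on the fibre sections `Θ^P_{(M, some e)}` -/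

omit [Fintype β] [Fintype δ] in
/-- The unit times the `b`-th summand of a fibre section at `w + u`:
`μ · Z_{M_b}(z'_b+t'_b) ∏_{b'≠b} P_{M_{b'}}(z'_{b'}+t'_{b'}) = comp_b · ∏_{b'≠b} A_{M_{b'}}`, where
`comp_b = B(P(t'_b); Z(z'_b), P(z'_b)) - B(P(z'_b); Z(t'_b), P(t'_b)) + C(P(z'_b), P(t'_b))` is the
companion law of the block `b`. [folklore] -/
theorem addUnit_mul_companion_prod (M : γ → Fin 3) (w u : β ⊕ (γ ⊕ δ) → ℂ) (b : γ) :
    addUnit (β := β) (δ := δ) L w u *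
        (L.univExtZ (M b) ((w + u) (iz b)) *
          ∏ b' ∈ Finset.univ.erase b, L.univExtP (M b') ((w + u) (iz b'))) =
      (L.chordB (M b) (blockP L u b) (blockZ L w b) (blockP L w b) -
          L.chordB (M b) (blockP L w b) (blockZ L u b) (blockP L u b) +
          L.chordC (M b) (blockP L w b) (blockP L u b)) *
        ∏ b' ∈ Finset.univ.erase b, L.chordA (M b') (blockP L w b') (blockP L u b') := by
  have hcomp : L.chordB (M b) (blockP L u b) (blockZ L w b) (blockP L w b) -
      L.chordB (M b) (blockP L w b) (blockZ L u b) (blockP L u b) +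
      L.chordC (M b) (blockP L w b) (blockP L u b) =
      -(L.weierstrassSigma (w (iz b) - u (iz b)) ^ 3 * L.univExtZ (M b) (w (iz b) + u (iz b))) :=
    L.chord_companion (M b) (w (iz b)) (u (iz b))
  have hA : ∀ b', L.chordA (M b') (blockP L w b') (blockP L u b') =
      -(L.weierstrassSigma (w (iz b') - u (iz b')) ^ 3) * L.univExtP (M b') (w (iz b') + u (iz b')) := by
    intro b'
    rw [show blockP L w b' = fun j => L.univExtP j (w (iz b')) from rfl,
      show blockP L u b' = fun j => L.univExtP j (u (iz b')) from rfl, L.chordA_univExtP]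
    ring
  unfold addUnit
  rw [← Finset.mul_prod_erase Finset.univ _ (Finset.mem_univ b)]
  simp only [Pi.add_apply]
  rw [show ∏ b' ∈ Finset.univ.erase b, L.chordA (M b') (blockP L w b') (blockP L u b') =
      (∏ b' ∈ Finset.univ.erase b, -(L.weierstrassSigma (w (iz b') - u (iz b')) ^ 3)) *
        ∏ b' ∈ Finset.univ.erase b, L.univExtP (M b') (w (iz b') + u (iz b')) by
    rw [← Finset.prod_mul_distrib]; exact Finset.prod_congr rfl fun b' _ => hA b']
  linear_combination -(∏ b' ∈ Finset.univ.erase b, -(L.weierstrassSigma (w (iz b') - u (iz b')) ^ 3)) *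
    (∏ b' ∈ Finset.univ.erase b, L.univExtP (M b') (w (iz b') + u (iz b'))) * hcomp

omit [Fintype β] [Fintype δ] in
/-- Regrouping the companion-linear part of the `b`-th summand over the Segre monomials:
`B(P(t'_b); Z(z'_b), P(z'_b)) ∏_{b'≠b} A_{M_{b'}} = ∑_{J,K} c_{M;J,K}(u) (Z_{J_b}(z'_b) ∏_{b'≠b} P_{J_{b'}}(z'_{b'})) Θ^P_{(K,none)}(w)`.
[folklore] -/
theorem chordB_mul_prod_chordA (M : γ → Fin 3) (w u : β ⊕ (γ ⊕ δ) → ℂ) (b : γ) :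
    L.chordB (M b) (blockP L u b) (blockZ L w b) (blockP L w b) *
        ∏ b' ∈ Finset.univ.erase b, L.chordA (M b') (blockP L w b') (blockP L u b') =
      ∑ J : γ → Fin 3, ∑ K : γ → Fin 3, addCoeffP L M J K u *
        ((blockZ L w b (J b) * ∏ b' ∈ Finset.univ.erase b, blockP L w b' (J b')) *
          ∏ b', blockP L w b' (K b')) := by
  set v : γ → Fin 3 → ℂ := fun b' => if b' = b then blockZ L w b else blockP L w b' with hv
  have key := prod_sum_sum_eq (fun b' j k => L.chordCoeff (M b') j k (blockP L u b')) v (blockP L w)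
  have hvb : v b = blockZ L w b := by simp [hv]
  have hvb' : ∀ b' ∈ Finset.univ.erase b, v b' = blockP L w b' := fun b' hb' => by
    simp [hv, Finset.ne_of_mem_erase hb']
  have h1 : ∏ b', ∑ j : Fin 3, ∑ k : Fin 3, L.chordCoeff (M b') j k (blockP L u b') * (v b' j * blockP L w b' k) =
      L.chordB (M b) (blockP L u b) (blockZ L w b) (blockP L w b) *
        ∏ b' ∈ Finset.univ.erase b, L.chordA (M b') (blockP L w b') (blockP L u b') := by
    rw [← Finset.mul_prod_erase Finset.univ _ (Finset.mem_univ b), hvb]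
    congr 1
    exact Finset.prod_congr rfl fun b' hb' => by rw [hvb' b' hb']; rfl
  have h2 : ∀ J : γ → Fin 3, ∏ b', v b' (J b') =
      blockZ L w b (J b) * ∏ b' ∈ Finset.univ.erase b, blockP L w b' (J b') := fun J => by
    rw [← Finset.mul_prod_erase Finset.univ _ (Finset.mem_univ b), hvb]
    congr 1
    exact Finset.prod_congr rfl fun b' hb' => by rw [hvb' b' hb']
  rw [← h1, key]
  simp only [h2]
  rfl

omit [Fintype β] [Fintype δ] in
/-- **The companion-linear part of the law**, summed over the blocks with the weights `κ_{eb}`: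
it is `∑_{J,K} c_{M;J,K}(u) (∑_b κ_{eb} Z_{J_b} ∏_{b'≠b} P_{J_{b'}})(w) Θ^P_{(K,none)}(w)`. [folklore] -/
theorem sum_chordB_mul_prod_chordA (M : γ → Fin 3) (e : δ) (w u : β ⊕ (γ ⊕ δ) → ℂ) :
    ∑ b, (κM e b : ℂ) * (L.chordB (M b) (blockP L u b) (blockZ L w b) (blockP L w b) *
        ∏ b' ∈ Finset.univ.erase b, L.chordA (M b') (blockP L w b') (blockP L u b')) =
      ∑ J : γ → Fin 3, ∑ K : γ → Fin 3, addCoeffP L M J K u *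
        ((∑ b, (κM e b : ℂ) * (L.univExtZ (J b) (w (iz b)) *
            ∏ b' ∈ Finset.univ.erase b, L.univExtP (J b') (w (iz b')))) *
          thetaPnone (β := β) (δ := δ) L K w) := by
  simp only [chordB_mul_prod_chordA, blockZ_apply, blockP_apply, thetaPnone, Finset.mul_sum,
    Finset.sum_mul]
  rw [Finset.sum_comm]
  refine Finset.sum_congr rfl fun J _ => ?_
  rw [Finset.sum_comm]
  refine Finset.sum_congr rfl fun K _ => Finset.sum_congr rfl fun b _ => ?_
  ring

omit [Fintype β] [Fintype δ] in
/-- Regrouping the remaining part of the `b`-th summand (companions of `u` and the correction)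
over the Segre monomials of `w`. [folklore] -/
theorem rest_mul_prod_chordA (M : γ → Fin 3) (w u : β ⊕ (γ ⊕ δ) → ℂ) (b : γ) :
    (L.chordB (M b) (blockP L w b) (blockZ L u b) (blockP L u b) -
          L.chordC (M b) (blockP L w b) (blockP L u b)) *
        ∏ b' ∈ Finset.univ.erase b, L.chordA (M b') (blockP L w b') (blockP L u b') =
      ∑ J : γ → Fin 3, ∑ K : γ → Fin 3,
        (((∑ j : Fin 3, ∑ k : Fin 3,
              L.chordCoeff₂ (M b) j k (J b) (K b) * (blockZ L u b j * blockP L u b k)) -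
            L.chordCcoeff (M b) (J b) (K b) (blockP L u b)) *
          ∏ b' ∈ Finset.univ.erase b, L.chordCoeff (M b') (J b') (K b') (blockP L u b')) *
        (thetaPnone (β := β) (δ := δ) L J w * thetaPnone (β := β) (δ := δ) L K w) := by
  set D : Fin 3 → Fin 3 → ℂ := fun l m =>
    (∑ j : Fin 3, ∑ k : Fin 3, L.chordCoeff₂ (M b) j k l m * (blockZ L u b j * blockP L u b k)) -
      L.chordCcoeff (M b) l m (blockP L u b) with hD
  set a : γ → Fin 3 → Fin 3 → ℂ := fun b' l m =>
    if b' = b then D l m else L.chordCoeff (M b') l m (blockP L u b') with ha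
  have key := prod_sum_sum_eq a (blockP L w) (blockP L w)
  have hab : a b = D := by funext l m; simp [ha]
  have hab' : ∀ b' ∈ Finset.univ.erase b, a b' = fun l m => L.chordCoeff (M b') l m (blockP L u b') :=
    fun b' hb' => by funext l m; simp [ha, Finset.ne_of_mem_erase hb']
  have hDsum : ∑ l : Fin 3, ∑ m : Fin 3, D l m * (blockP L w b l * blockP L w b m) =
      L.chordB (M b) (blockP L w b) (blockZ L u b) (blockP L u b) -
        L.chordC (M b) (blockP L w b) (blockP L u b) := by
    rw [L.chordB_eq_sum_left, L.chordC_eq_sum, ← Finset.sum_sub_distrib]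
    refine Finset.sum_congr rfl fun l _ => ?_
    rw [← Finset.sum_sub_distrib]
    refine Finset.sum_congr rfl fun m _ => ?_
    rw [hD]
    ring
  have h1 : ∏ b', ∑ l : Fin 3, ∑ m : Fin 3, a b' l m * (blockP L w b' l * blockP L w b' m) =
      (L.chordB (M b) (blockP L w b) (blockZ L u b) (blockP L u b) -
          L.chordC (M b) (blockP L w b) (blockP L u b)) *
        ∏ b' ∈ Finset.univ.erase b, L.chordA (M b') (blockP L w b') (blockP L u b') := by
    rw [← Finset.mul_prod_erase Finset.univ _ (Finset.mem_univ b), hab, hDsum]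
    congr 1
    exact Finset.prod_congr rfl fun b' hb' => by rw [hab' b' hb']; rfl
  have h2 : ∀ J K : γ → Fin 3, ∏ b', a b' (J b') (K b') =
      D (J b) (K b) * ∏ b' ∈ Finset.univ.erase b, L.chordCoeff (M b') (J b') (K b') (blockP L u b') :=
    fun J K => by
    rw [← Finset.mul_prod_erase Finset.univ _ (Finset.mem_univ b), hab]
    congr 1
    exact Finset.prod_congr rfl fun b' hb' => by rw [hab' b' hb']
  rw [← h1, key]
  simp only [h2]
  rfl

omit [Fintype β] [Fintype δ] in
/-- **The remaining part of the law**, summed over the blocks with the weights `κ_{eb}`: it is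
`∑_{J,K} (d^e_{M;J,K}(u) - s_e(u) c_{M;J,K}(u)) Θ^P_{(J,none)}(w) Θ^P_{(K,none)}(w)`. [folklore] -/
theorem sum_rest_mul_prod_chordA (M : γ → Fin 3) (e : δ) (w u : β ⊕ (γ ⊕ δ) → ℂ) :
    ∑ b, (κM e b : ℂ) * ((L.chordB (M b) (blockP L w b) (blockZ L u b) (blockP L u b) -
          L.chordC (M b) (blockP L w b) (blockP L u b)) *
        ∏ b' ∈ Finset.univ.erase b, L.chordA (M b') (blockP L w b') (blockP L u b')) =
      ∑ J : γ → Fin 3, ∑ K : γ → Fin 3,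
        (addCoeffS L κM M e J K u - u (is e) * addCoeffP L M J K u) *
          (thetaPnone (β := β) (δ := δ) L J w * thetaPnone (β := β) (δ := δ) L K w) := by
  simp only [rest_mul_prod_chordA, addCoeffS, add_sub_cancel_left, Finset.mul_sum, Finset.sum_mul]
  rw [Finset.sum_comm]
  refine Finset.sum_congr rfl fun J _ => ?_
  rw [Finset.sum_comm]
  refine Finset.sum_congr rfl fun K _ => Finset.sum_congr rfl fun b _ => ?_
  ring

omit [Fintype β] [Fintype δ] in
/-- **The addition law for the fibre sections `Θ^P_{(M, some e)}`**:
`μ(w,u) Θ^P_{(M,some e)}(w + u) = ∑_{J,K} c_{M;J,K}(u) Θ^P_{(J,some e)}(w) Θ^P_{(K,none)}(w)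
  + ∑_{J,K} d^e_{M;J,K}(u) Θ^P_{(J,none)}(w) Θ^P_{(K,none)}(w)` — linear in the fibre sections of
`w`, with the SAME coefficients `c` as the blocks. [folklore] -/
theorem thetaPsome_add (M : γ → Fin 3) (e : δ) (w u : β ⊕ (γ ⊕ δ) → ℂ) :
    addUnit (β := β) (δ := δ) L w u * thetaPsome (β := β) L κM M e (w + u) =
      ∑ J : γ → Fin 3, ∑ K : γ → Fin 3,
          addCoeffP L M J K u * (thetaPsome (β := β) L κM J e w * thetaPnone (β := β) (δ := δ) L K w) +
        ∑ J : γ → Fin 3, ∑ K : γ → Fin 3,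
          addCoeffS L κM M e J K u * (thetaPnone (β := β) (δ := δ) L J w * thetaPnone (β := β) (δ := δ) L K w) := by
  have h0 := thetaPnone_add (β := β) (δ := δ) L M w u
  have hb := fun b => addUnit_mul_companion_prod (β := β) (δ := δ) L M w u b
  have h5 := sum_chordB_mul_prod_chordA L κM M e w u
  have h6 := sum_rest_mul_prod_chordA L κM M e w u
  calc addUnit (β := β) (δ := δ) L w u * thetaPsome (β := β) L κM M e (w + u)
      = (w (is e) + u (is e)) * (addUnit (β := β) (δ := δ) L w u * thetaPnone (β := β) (δ := δ) L M (w + u)) -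
          ∑ b, (κM e b : ℂ) * (addUnit (β := β) (δ := δ) L w u *
            (L.univExtZ (M b) ((w + u) (iz b)) *
              ∏ b' ∈ Finset.univ.erase b, L.univExtP (M b') ((w + u) (iz b')))) := by
        unfold thetaPsome
        rw [Pi.add_apply, mul_sub, Finset.mul_sum]
        congr 1
        · ring
        · exact Finset.sum_congr rfl fun b _ => by ring
    _ = (w (is e) + u (is e)) * (∑ J : γ → Fin 3, ∑ K : γ → Fin 3,
            addCoeffP L M J K u * (thetaPnone (β := β) (δ := δ) L J w * thetaPnone (β := β) (δ := δ) L K w)) -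
          (∑ b, (κM e b : ℂ) * (L.chordB (M b) (blockP L u b) (blockZ L w b) (blockP L w b) *
              ∏ b' ∈ Finset.univ.erase b, L.chordA (M b') (blockP L w b') (blockP L u b')) -
            ∑ b, (κM e b : ℂ) * ((L.chordB (M b) (blockP L w b) (blockZ L u b) (blockP L u b) -
                L.chordC (M b) (blockP L w b) (blockP L u b)) *
              ∏ b' ∈ Finset.univ.erase b, L.chordA (M b') (blockP L w b') (blockP L u b'))) := by
        rw [h0, ← Finset.sum_sub_distrib]
        congr 1
        exact Finset.sum_congr rfl fun b _ => by rw [hb b]; ring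
    _ = _ := by
        rw [h5, h6]
        simp only [Finset.mul_sum, ← Finset.sum_sub_distrib, ← Finset.sum_add_distrib]
        refine Finset.sum_congr rfl fun J _ => Finset.sum_congr rfl fun K _ => ?_
        unfold thetaPsome
        ring

/-! ### The law on the theta functions of `M_κ` -/

omit [Fintype β] [Fintype γ] [Fintype δ] [DecidableEq γ] in
/-- The torus coordinates are characters: `T_a(w + u) = T_a(u) T_a(w)`. [folklore] -/
theorem thetaT_add (a : Option β) (w u : β ⊕ (γ ⊕ δ) → ℂ) :
    thetaT (γ := γ) (δ := δ) a (w + u) = thetaT a u * thetaT a w := by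
  rcases a with _ | j
  · simp
  · simp only [thetaT_some, Pi.add_apply, Complex.exp_add]
    ring

omit [Fintype β] [Fintype δ] in
/-- **The addition law of the theta model of `M_κ`, block coordinates**: for all `w, u ∈ Lie M_κ,ℂ`,
`μ(w, u) Θ_{(a,(M,none))}(w + u) = ∑_{J,K} T_a(u) c_{M;J,K}(u) · Θ_{(a,(J,none))}(w) Θ_{(none,(K,none))}(w)`:
a form of degree `2` in `Θ(w)` whose coefficients are entire functions of `u`, with the unit
`μ(w, u) = ∏_b (-σ(z'_b - t'_b)³)` (non-zero off the block diagonals). [folklore] -/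
theorem theta_add_none (a : Option β) (M : γ → Fin 3) (w u : β ⊕ (γ ⊕ δ) → ℂ) :
    addUnit (β := β) (δ := δ) L w u * theta L κM (a, (M, none)) (w + u) =
      ∑ J : γ → Fin 3, ∑ K : γ → Fin 3, (thetaT (γ := γ) (δ := δ) a u * addCoeffP L M J K u) *
        (theta L κM (a, (J, none)) w * theta L κM (none, (K, none)) w) := by
  simp only [theta, thetaP_none, thetaT_none, one_mul, thetaT_add]
  rw [mul_left_comm, thetaPnone_add, Finset.mul_sum]
  refine Finset.sum_congr rfl fun J _ => ?_
  rw [Finset.mul_sum]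
  refine Finset.sum_congr rfl fun K _ => ?_
  ring

omit [Fintype β] [Fintype δ] in
/-- **The addition law of the theta model of `M_κ`, fibre coordinates**: for all `w, u`,
`μ(w, u) Θ_{(a,(M,some e))}(w + u) = ∑_{J,K} T_a(u) c_{M;J,K}(u) · Θ_{(a,(J,some e))}(w) Θ_{(none,(K,none))}(w)
  + ∑_{J,K} T_a(u) d^e_{M;J,K}(u) · Θ_{(a,(J,none))}(w) Θ_{(none,(K,none))}(w)`. [folklore] -/
theorem theta_add_some (a : Option β) (M : γ → Fin 3) (e : δ) (w u : β ⊕ (γ ⊕ δ) → ℂ) :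
    addUnit (β := β) (δ := δ) L w u * theta L κM (a, (M, some e)) (w + u) =
      ∑ J : γ → Fin 3, ∑ K : γ → Fin 3, (thetaT (γ := γ) (δ := δ) a u * addCoeffP L M J K u) *
          (theta L κM (a, (J, some e)) w * theta L κM (none, (K, none)) w) +
        ∑ J : γ → Fin 3, ∑ K : γ → Fin 3, (thetaT (γ := γ) (δ := δ) a u * addCoeffS L κM M e J K u) *
          (theta L κM (a, (J, none)) w * theta L κM (none, (K, none)) w) := by
  simp only [theta, thetaP_some, thetaP_none, thetaT_none, one_mul, thetaT_add]
  rw [mul_left_comm, thetaPsome_add, mul_add, Finset.mul_sum, Finset.mul_sum]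
  congr 1
  · refine Finset.sum_congr rfl fun J _ => ?_
    rw [Finset.mul_sum]
    refine Finset.sum_congr rfl fun K _ => ?_
    ring
  · refine Finset.sum_congr rfl fun J _ => ?_
    rw [Finset.mul_sum]
    refine Finset.sum_congr rfl fun K _ => ?_
    ring

/-! ### Holomorphy of the unit and of the coefficients -/

/-- The unit `μ(w, u)` is an entire function of `(w, u)`. [folklore] -/
theorem differentiable_addUnit :
    Differentiable ℂ fun p : (β ⊕ (γ ⊕ δ) → ℂ) × (β ⊕ (γ ⊕ δ) → ℂ) =>
      addUnit (β := β) (δ := δ) L p.1 p.2 := by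
  unfold addUnit
  refine differentiable_finset_prod
    (g := fun b (p : (β ⊕ (γ ⊕ δ) → ℂ) × (β ⊕ (γ ⊕ δ) → ℂ)) =>
      -(L.weierstrassSigma (p.1 (iz b) - p.2 (iz b)) ^ 3)) Finset.univ fun b _ => ?_
  have hσ := L.differentiable_weierstrassSigma_holds
  have hl : Differentiable ℂ fun p : (β ⊕ (γ ⊕ δ) → ℂ) × (β ⊕ (γ ⊕ δ) → ℂ) =>
      p.1 (iz b) - p.2 (iz b) := by
    fun_prop
  exact ((hσ.comp hl).pow 3).neg

omit [DecidableEq γ] in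
/-- The coefficient forms of the chord law along a block are entire in `u`. [folklore] -/
theorem differentiable_chordCoeff_blockP (i j k : Fin 3) (b : γ) :
    Differentiable ℂ fun u : β ⊕ (γ ⊕ δ) → ℂ => L.chordCoeff i j k (blockP L u b) := by
  have h : (fun u : β ⊕ (γ ⊕ δ) → ℂ => L.chordCoeff i j k (blockP L u b)) =
      fun u => ∑ l : Fin 3, ∑ m : Fin 3,
        L.chordCoeff₂ i j k l m * (L.univExtP l (u (iz b)) * L.univExtP m (u (iz b))) := by
    funext u; rw [L.chordCoeff_eq_sum]; rfl
  have h0 := differentiable_univExtP_comp (β := β) (δ := δ) L 0 b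
  have h1 := differentiable_univExtP_comp (β := β) (δ := δ) L 1 b
  have h2 := differentiable_univExtP_comp (β := β) (δ := δ) L 2 b
  rw [h]
  simp only [Fin.sum_univ_three]
  fun_prop

omit [DecidableEq γ] in
/-- The `x`-coefficient forms of the correction along a block are entire in `u`. [folklore] -/
theorem differentiable_chordCcoeff_blockP (i l m : Fin 3) (b : γ) :
    Differentiable ℂ fun u : β ⊕ (γ ⊕ δ) → ℂ => L.chordCcoeff i l m (blockP L u b) := by
  have h0 := differentiable_univExtP_comp (β := β) (δ := δ) L 0 b
  have h1 := differentiable_univExtP_comp (β := β) (δ := δ) L 1 b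
  have h2 := differentiable_univExtP_comp (β := β) (δ := δ) L 2 b
  unfold PeriodPair.chordCcoeff
  simp only [Fin.sum_univ_three, blockP_apply]
  fun_prop

omit [DecidableEq γ] in
/-- The bilinear companion expressions along a block are entire in `u`. [folklore] -/
theorem differentiable_companion_blockZP (i l m : Fin 3) (b : γ) :
    Differentiable ℂ fun u : β ⊕ (γ ⊕ δ) → ℂ =>
      ∑ j : Fin 3, ∑ k : Fin 3, L.chordCoeff₂ i j k l m * (blockZ L u b j * blockP L u b k) := by
  have h0 := differentiable_univExtP_comp (β := β) (δ := δ) L 0 b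
  have h1 := differentiable_univExtP_comp (β := β) (δ := δ) L 1 b
  have h2 := differentiable_univExtP_comp (β := β) (δ := δ) L 2 b
  have z0 := differentiable_univExtZ_comp (β := β) (δ := δ) L 0 b
  have z1 := differentiable_univExtZ_comp (β := β) (δ := δ) L 1 b
  have z2 := differentiable_univExtZ_comp (β := β) (δ := δ) L 2 b
  simp only [Fin.sum_univ_three, blockP_apply, blockZ_apply]
  fun_prop

/-- **The coefficients `c_{M;J,K}(u)` are entire.** [folklore] -/
theorem differentiable_addCoeffP (M J K : γ → Fin 3) :
    Differentiable ℂ fun u : β ⊕ (γ ⊕ δ) → ℂ => addCoeffP L M J K u := by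
  unfold addCoeffP
  exact differentiable_finset_prod
    (g := fun b (u : β ⊕ (γ ⊕ δ) → ℂ) => L.chordCoeff (M b) (J b) (K b) (blockP L u b))
    Finset.univ fun b _ => differentiable_chordCoeff_blockP L (M b) (J b) (K b) b

/-- **The coefficients `d^e_{M;J,K}(u)` are entire.** [folklore] -/
theorem differentiable_addCoeffS (M : γ → Fin 3) (e : δ) (J K : γ → Fin 3) :
    Differentiable ℂ fun u : β ⊕ (γ ⊕ δ) → ℂ => addCoeffS L κM M e J K u := by
  have hc := differentiable_addCoeffP (β := β) (δ := δ) L M J K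
  have hs : Differentiable ℂ fun u : β ⊕ (γ ⊕ δ) → ℂ => u (is e) := differentiable_apply (𝕜 := ℂ) (is e)
  have hsum : Differentiable ℂ fun u : β ⊕ (γ ⊕ δ) → ℂ => ∑ b, (κM e b : ℂ) *
      (((∑ j : Fin 3, ∑ k : Fin 3,
          L.chordCoeff₂ (M b) j k (J b) (K b) * (blockZ L u b j * blockP L u b k)) -
        L.chordCcoeff (M b) (J b) (K b) (blockP L u b)) *
      ∏ b' ∈ Finset.univ.erase b, L.chordCoeff (M b') (J b') (K b') (blockP L u b')) := by
    refine Differentiable.fun_sum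
      (A := fun b (u : β ⊕ (γ ⊕ δ) → ℂ) => (κM e b : ℂ) *
        (((∑ j : Fin 3, ∑ k : Fin 3,
            L.chordCoeff₂ (M b) j k (J b) (K b) * (blockZ L u b j * blockP L u b k)) -
          L.chordCcoeff (M b) (J b) (K b) (blockP L u b)) *
        ∏ b' ∈ Finset.univ.erase b, L.chordCoeff (M b') (J b') (K b') (blockP L u b')))
      fun b _ => ?_
    have hpr : Differentiable ℂ fun u : β ⊕ (γ ⊕ δ) → ℂ =>
        ∏ b' ∈ Finset.univ.erase b, L.chordCoeff (M b') (J b') (K b') (blockP L u b') :=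
      differentiable_finset_prod
        (g := fun b' (u : β ⊕ (γ ⊕ δ) → ℂ) => L.chordCoeff (M b') (J b') (K b') (blockP L u b'))
        (Finset.univ.erase b) fun b' _ => differentiable_chordCoeff_blockP L (M b') (J b') (K b') b'
    exact (differentiable_const _).mul
      (((differentiable_companion_blockZP L (M b) (J b) (K b) b).sub
        (differentiable_chordCcoeff_blockP L (M b) (J b) (K b) b)).mul hpr)
  unfold addCoeffS
  exact (hs.mul hc).add hsum

/-! ### Good auxiliary points exist -/

omit [Fintype β] [Fintype γ] [Fintype δ] [DecidableEq γ] in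
/-- For any two points `a, σ` there is an auxiliary `s` off all the relevant block diagonals:
`a_b + s_b ∉ Λ` and `a_b - σ_b - 2 s_b ∉ Λ` for all `b` (countably many excluded values per
block) — so that the units `μ(w, -s)` at `w = a` and `μ(w - s, z + s)` at `(a, σ)` are non-zero
(composition of two laws through the intermediate point `a - s`). [folklore] -/
theorem exists_aux_point (a σ : β ⊕ (γ ⊕ δ) → ℂ) :
    ∃ s : β ⊕ (γ ⊕ δ) → ℂ, (∀ b, a (iz b) + s (iz b) ∉ L.lattice) ∧
      ∀ b, a (iz b) - σ (iz b) - 2 * s (iz b) ∉ L.lattice := by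
  -- blockwise choice off a countable set, by density of its complement
  have hΛ : (L.lattice : Set ℂ).Countable := by
    have : (L.lattice : Set ℂ) ⊆
        Set.range (fun p : ℤ × ℤ => (p.1 : ℂ) * L.ω₁ + (p.2 : ℂ) * L.ω₂) := by
      intro x hx
      obtain ⟨m, n, h⟩ := PeriodPair.mem_lattice.mp hx
      exact ⟨(m, n), h⟩
    exact (Set.countable_range _).mono this
  have hb : ∀ b : γ, ∃ c : ℂ, a (iz b) + c ∉ L.lattice ∧ a (iz b) - σ (iz b) - 2 * c ∉ L.lattice := by
    intro b
    have hc : ((fun l : ℂ => l - a (iz b)) '' (L.lattice : Set ℂ) ∪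
        (fun l : ℂ => (a (iz b) - σ (iz b) - l) / 2) '' (L.lattice : Set ℂ)).Countable :=
      (hΛ.image _).union (hΛ.image _)
    obtain ⟨c, hc⟩ := (hc.dense_compl ℂ).nonempty
    simp only [Set.mem_compl_iff, Set.mem_union, Set.mem_image, SetLike.mem_coe, not_or,
      not_exists, not_and] at hc
    refine ⟨c, fun h => hc.1 _ h (by ring), fun h => hc.2 _ h (by ring)⟩
  choose c hc using hb
  refine ⟨fun i => Sum.elim (fun _ => 0) (Sum.elim c fun _ => 0) i, fun b => ?_, fun b => ?_⟩
  · simpa [iz] using (hc b).1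
  · simpa [iz] using (hc b).2

end Std

end GaGmE

end Literature.NumberTheory.Transcendental

end
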